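import Summits.AnomalousDissipation.AnomalousDissipation.Theorems.BaireTransferRobustLoudUpgradeStubLsFamilyPeriodicA

/-!
# Stub `stub_lsFamilyPeriodic` of the line `malkin-cone-group-orbits` (crux stmt-AnomalousDissipation-1144, companion c3),
# helper for the FOLD OF CYCLES: the phase functional `Re ⟪g, ·⟫` on `W` and the bordered bilinear map on `W × ℝ`

Helper file (pure proofs) for the periodic fold member of the family.  The robust-crossing-at-a-fold engine
`Literature.Analysis.Calculus.robustCrossing_of_fold` wants the bordered free-period lattice map
`N̂(x, ω) = (ω ∂ₛx + L₀x + B(x,x), φ x)` of the periodic Lyapunov–Schmidt family written EXACTLY as `Â + B̂(·,·)`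
with `Â` continuous linear and `B̂` continuous bilinear on `W × ℝ` and NO constant term.  We supply:

* `exists_phaseFunctional` — for `g, x₀ ∈ W` with `g = (2πi n) x₀` coefficientwise (the phase direction
  `g ∼ ∂ₛx₀` of the orbit's state vector `x₀`), the natural phase functional `φ := Re ⟪g, ·⟫_{ℓ²}` restricted to
  `W`: a continuous real-linear functional with `φ g = ‖g‖²` and `φ x₀ = 0` (the `ℓ²` inner product is the sum
  of the coordinate inner products `⟪(2πi n) v, v⟫ = −2πi n ‖v‖²`, all purely imaginary);
* `quadratic_form_periodicMap` — the algebraic identity `N̂ q = Â q + B̂ q q` for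
  `Â := (L₀ ∘ fst, φ ∘ fst)` and any `B̂` with `B̂ q q' = (q.2 • ∂ₛ q'.1 + B q.1 q'.1, 0)`;
* the registered part `lsFamilyPeriodic_partD` — existence of that continuous bilinear map `B̂` on `E × ℝ` for a
  continuous linear `∂ₛ = Ds` and a bounded bilinear `B` (Mathlib's algebra of continuous bilinear maps:
  `lsmul`, `bilinearComp`, `compL`, `inl`).

References: Kielhöfer 2012 §I.4–I.5, §I.8; Chow–Hale 1982 §2.4, Ch. 6; Iooss 1972 §2–3.
-/

-- `Summit.<Summit>.<Problem>` is the tree's mandated summit-side namespace (CONVENTIONS §2); for this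
-- single-conjunct summit the two coincide, so the duplicate is deliberate.
set_option linter.dupNamespace false

noncomputable section

open scoped BigOperators Topology ENNReal NNReal ComplexConjugate
open Filter Set Function MeasureTheory UnitAddTorus

namespace Summit.AnomalousDissipation.AnomalousDissipation.Theorems.RobustLoudUpgrade.LsFamilyPeriodic

open Literature.Analysis.FunctionSpaces Literature.Analysis.FunctionSpaces.Torus
open Literature.Analysis.FunctionSpaces.EuclideanSpace
open Literature.Analysis.FluidPDE
open Literature.Analysis.FluidPDE.ScalarFourier
open Literature.Analysis.FluidPDE.TimePeriodicLattice
open Summit.AnomalousDissipation.AnomalousDissipation.Theses.BaireTransfer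

-- NOTATION START (verbatim from `PeriodicNSOrbitPersistsProofs`)
/-- Local notation: the parabolic weight `Λ(n, k) = |n| + |k|²`. -/
local notation:max "Λ" m:max => (|((Prod.fst m : ℤ) : ℝ)| + freqNormSq (Prod.snd m))

/-- Local notation: the convective symbol on `ℤ × ℤ³` (as in `TimePeriodicNSLattice`). -/
local notation:max "𝐍[" a ", " b "]" m:max =>
  (WithLp.toLp 2 (fun p : Fin 3 => ∑ j : Fin 3, ∑' m' : ℤ × (Fin 3 → ℤ),
    a m' j * (dsym j (Prod.snd m - Prod.snd m') * b (m - m') p)) : EuclideanSpace ℂ (Fin 3))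

/-- Local notation: division by the weight. -/
local notation:max "𝐜" x:max => (fun mm : ℤ × (Fin 3 → ℤ) =>
  ((((|((Prod.fst mm : ℤ) : ℝ)| + freqNormSq (Prod.snd mm))⁻¹ : ℝ) : ℂ) • x mm))

/-- Local notation: multiplication by the weight. -/
local notation:max "𝐬" x:max => (fun mm : ℤ × (Fin 3 → ℤ) =>
  ((((|((Prod.fst mm : ℤ) : ℝ)| + freqNormSq (Prod.snd mm)) : ℝ) : ℂ) • x mm))

/-- Local notation: the family of coefficients of `x ∈ W ⊂ ℓ²`. -/
local notation:max "𝐰" x:max =>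
  (((x : lp (fun _ : ℤ × (Fin 3 → ℤ) => EuclideanSpace ℂ (Fin 3)) 2)) : ℤ × (Fin 3 → ℤ) → EuclideanSpace ℂ (Fin 3))

/-- Local notation: the extension `K ↦ c (K₀, tail K)` of a lattice family to `ℤ⁴`. -/
local notation:max "𝐄" c:max => (fun K : Fin 4 → ℤ => c ((K 0, Fin.tail K) : ℤ × (Fin 3 → ℤ)))

/-- Local notation: the lattice family `û(n,k) = 𝓕(complexify ∘ (U − m₀))(n,k)`. -/
local notation:max "𝐮[" U ", " m₀ "]" => (fun mm : ℤ × (Fin 3 → ℤ) =>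
  mFourierCoeff (EuclideanSpace.complexify ∘ fun y : UnitAddTorus (Fin 4) => U y - m₀)
    (Fin.cons (Prod.fst mm) (Prod.snd mm) : Fin 4 → ℤ))

/-- Local notation: the force family `y_F(n,k) = [k ≠ 0][n = 0] 𝓕(complexify ∘ F)(k)`. -/
local notation:max "𝐲" F:max => (fun mm : ℤ × (Fin 3 → ℤ) =>
  (ite (Prod.snd mm = 0) (0 : EuclideanSpace ℂ (Fin 3))
    (ite (Prod.fst mm = 0) (mFourierCoeff (EuclideanSpace.complexify ∘ F) (Prod.snd mm)) 0)))

/-- Local notation: the lattice family of the orbit `u` with period `τ`. -/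
local notation:max "𝐨[" τ ", " u "]" => (fun mm : ℤ × (Fin 3 → ℤ) =>
  mFourierCoeff (EuclideanSpace.complexify ∘ fun y : UnitAddTorus (Fin 4) => Torus.timeRoll τ u y - ∫ x, u 0 x)
    (Fin.cons (Prod.fst mm) (Prod.snd mm) : Fin 4 → ℤ))
/-- Local notation: the time multiplier `dₛ(n,k) = 2πi n / Λ(n,k)`. -/
local notation "dS" => (fun mm : ℤ × (Fin 3 → ℤ) =>
  (2 * Real.pi * Complex.I * ((Prod.fst mm : ℤ) : ℂ)) * ((((|((Prod.fst mm : ℤ) : ℝ)| + freqNormSq (Prod.snd mm)) : ℝ) : ℂ))⁻¹)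

/-- Local notation: the Stokes–drift multiplier `(4π²ν|k|² + 2πi m₀·k) / Λ(n,k)`. -/
local notation "dL[" ν ", " m₀ "]" => (fun mm : ℤ × (Fin 3 → ℤ) =>
  (((4 * Real.pi ^ 2 * ν * freqNormSq (Prod.snd mm) : ℝ) : ℂ) +
      2 * Real.pi * Complex.I * (∑ jj : Fin 3, ((m₀ jj : ℝ) : ℂ) * (((Prod.snd mm) jj : ℤ) : ℂ))) *
    ((((|((Prod.fst mm : ℤ) : ℝ)| + freqNormSq (Prod.snd mm)) : ℝ) : ℂ))⁻¹)

/-- Local notation: the symbol `σ_om(n,k) = 2πiomn + 4π²ν|k|² + 2πi m₀·k`. -/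
local notation "σ[" om ", " ν ", " m₀ "]" => (fun mm : ℤ × (Fin 3 → ℤ) =>
  2 * Real.pi * Complex.I * ((om : ℝ) : ℂ) * ((Prod.fst mm : ℤ) : ℂ) +
    (((4 * Real.pi ^ 2 * ν * freqNormSq (Prod.snd mm) : ℝ)) : ℂ) +
    2 * Real.pi * Complex.I * (∑ jj : Fin 3, ((m₀ jj : ℝ) : ℂ) * (((Prod.snd mm) jj : ℤ) : ℂ)))
-- NOTATION END

variable {W : Submodule ℝ (lp (fun _ : ℤ × (Fin 3 → ℤ) => EuclideanSpace ℂ (Fin 3)) 2)}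

/-! ## §1 The phase functional `Re ⟪g, ·⟫` on `W` -/

section Phase

/-- **Phase functional of the periodic fold member.**  If `g, x₀ ∈ W` satisfy `g(n,k) = (2πi n) x₀(n,k)` for all
`(n, k)` (the phase direction of the orbit's state vector), then `φ := Re ⟪g, ·⟫_{ℓ²}` restricted to `W` is a
continuous real-linear functional with `φ g = ‖g‖²`, `φ x₀ = 0`, and `φ h = Re ⟪g, h⟫` for every `h ∈ W`
(`⟪g, x₀⟫ = ∑ ⟪(2πi n) x₀(n,k), x₀(n,k)⟫ = −∑ 2πi n ‖x₀(n,k)‖²` is purely imaginary). [folklore] -/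
theorem exists_phaseFunctional (g x₀ : W)
    (hg : ∀ m : ℤ × (Fin 3 → ℤ), (𝐰 g) m = (2 * Real.pi * Complex.I * (m.1 : ℂ)) • (𝐰 x₀) m) :
    ∃ φ : W →L[ℝ] ℝ, φ g = ‖g‖ ^ 2 ∧ φ x₀ = 0 ∧
      ∀ h : W, φ h = (inner ℂ (g : lp (fun _ : ℤ × (Fin 3 → ℤ) => EuclideanSpace ℂ (Fin 3)) 2)
        (h : lp (fun _ : ℤ × (Fin 3 → ℤ) => EuclideanSpace ℂ (Fin 3)) 2)).re := by
  refine ⟨Complex.reCLM.comp ((((innerSL ℂ (g : lp (fun _ : ℤ × (Fin 3 → ℤ) => EuclideanSpace ℂ (Fin 3)) 2)) :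
    lp (fun _ : ℤ × (Fin 3 → ℤ) => EuclideanSpace ℂ (Fin 3)) 2 →L[ℂ] ℂ).restrictScalars ℝ).comp W.subtypeL),
    ?_, ?_, fun h => rfl⟩
  · -- `Re ⟪g, g⟫ = ‖g‖²`
    change (inner ℂ (g : lp (fun _ : ℤ × (Fin 3 → ℤ) => EuclideanSpace ℂ (Fin 3)) 2)
        (g : lp (fun _ : ℤ × (Fin 3 → ℤ) => EuclideanSpace ℂ (Fin 3)) 2)).re = ‖g‖ ^ 2
    rw [inner_self_eq_norm_sq_to_K, ← norm_coeW]
    norm_cast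
  · -- `Re ⟪g, x₀⟫ = ∑ Re ⟪(2πi n) x₀(n,k), x₀(n,k)⟫ = 0`
    change (inner ℂ (g : lp (fun _ : ℤ × (Fin 3 → ℤ) => EuclideanSpace ℂ (Fin 3)) 2)
        (x₀ : lp (fun _ : ℤ × (Fin 3 → ℤ) => EuclideanSpace ℂ (Fin 3)) 2)).re = 0
    have h1 := Complex.hasSum_re (lp.hasSum_inner (𝕜 := ℂ)
      (g : lp (fun _ : ℤ × (Fin 3 → ℤ) => EuclideanSpace ℂ (Fin 3)) 2)
      (x₀ : lp (fun _ : ℤ × (Fin 3 → ℤ) => EuclideanSpace ℂ (Fin 3)) 2))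
    have h2 : HasSum (fun m : ℤ × (Fin 3 → ℤ) => (inner ℂ ((𝐰 g) m) ((𝐰 x₀) m)).re) 0 := by
      have h3 : ∀ m : ℤ × (Fin 3 → ℤ), (inner ℂ ((𝐰 g) m) ((𝐰 x₀) m)).re = 0 := by
        intro m
        rw [hg m, inner_smul_left, inner_self_eq_norm_sq_to_K]
        simp only [map_mul, map_ofNat, Complex.conj_ofReal, Complex.conj_I, map_intCast, Complex.coe_algebraMap,
          ← Complex.ofReal_pow, Complex.mul_re, Complex.mul_im, Complex.ofReal_re, Complex.ofReal_im, Complex.I_re,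
          Complex.I_im, Complex.intCast_re, Complex.intCast_im, Complex.neg_re, Complex.neg_im, Complex.re_ofNat,
          Complex.im_ofNat]
        ring
      simp_rw [h3]
      exact hasSum_zero
    exact h1.unique h2

end Phase

/-! ## §2 The quadratic form of the bordered free-period map on `E × ℝ` -/

section Quadratic

variable {E : Type*} [NormedAddCommGroup E] [NormedSpace ℝ E]

/-- **The bordered free-period map is exactly quadratic.**  With `Â := (L₀ ∘ fst, φ ∘ fst)` and any bilinear `B̂`
with `B̂ q q' = (q.2 • Ds q'.1 + B q.1 q'.1, 0)` (the registered part `lsFamilyPeriodic_partD` provides one),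
`(ω Ds x + L₀ x + B x x, φ x) = Â (x, ω) + B̂ (x, ω) (x, ω)` — the shape `N = A + B(·,·)` of
`Literature.Analysis.Calculus.robustCrossing_of_fold`. [folklore] -/
theorem quadratic_form_periodicMap (Ds L₀ : E →L[ℝ] E) (B : E → E → E) (φ : E →L[ℝ] ℝ)
    (Bh : (E × ℝ) →L[ℝ] (E × ℝ) →L[ℝ] (E × ℝ)) (hBh : ∀ q q' : E × ℝ, Bh q q' = (q.2 • Ds q'.1 + B q.1 q'.1, 0))
    (q : E × ℝ) :
    ((q.2 • Ds q.1 + L₀ q.1 + B q.1 q.1, φ q.1) : E × ℝ) =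
      ((L₀.comp (ContinuousLinearMap.fst ℝ E ℝ)).prod (φ.comp (ContinuousLinearMap.fst ℝ E ℝ))) q + Bh q q := by
  rw [hBh, ContinuousLinearMap.prod_apply, Prod.mk_add_mk, add_zero, ContinuousLinearMap.comp_apply,
    ContinuousLinearMap.comp_apply, ContinuousLinearMap.coe_fst', Prod.mk.injEq]
  exact ⟨by abel, rfl⟩

end Quadratic

/-! ## Registered part (sub-goal `lsFamilyPeriodic_partD` of stmt-AnomalousDissipation-1144) -/

/-- **Registered sub-goal `lsFamilyPeriodic_partD`** (companion c3): the BORDERED BILINEAR MAP on `E × ℝ`.  For a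
continuous linear `Ds` (the time derivative `∂ₛ` on the lattice) and a bounded bilinear `B` there is a continuous
bilinear `B̂ : (E × ℝ) × (E × ℝ) → E × ℝ` with `B̂ (x, ω) (x', ω') = (ω Ds x' + B x x', 0)` — the quadratic part of
the bordered free-period map `(x, ω) ↦ (ω ∂ₛx + L₀x + B(x,x), φ x)` (built from Mathlib's `lsmul`, `bilinearComp`,
`compL`, `inl`). [folklore] -/
theorem lsFamilyPeriodic_partD : ∀ (E : Type) [NormedAddCommGroup E] [NormedSpace ℝ E] (Ds : E →L[ℝ] E) (B : E → E → E), IsBoundedBilinearMap ℝ (fun p : E × E => B p.1 p.2) → ∃ Bh : (E × ℝ) →L[ℝ] (E × ℝ) →L[ℝ] (E × ℝ), ∀ q q' : E × ℝ, Bh q q' = (q.2 • Ds q'.1 + B q.1 q'.1, 0) := by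
  intro E _ _ Ds B hB
  refine ⟨(ContinuousLinearMap.compL ℝ (E × ℝ) E (E × ℝ) (ContinuousLinearMap.inl ℝ E ℝ)).comp
    ((ContinuousLinearMap.lsmul ℝ ℝ).bilinearComp (ContinuousLinearMap.snd ℝ E ℝ)
      (Ds.comp (ContinuousLinearMap.fst ℝ E ℝ)) +
     hB.toContinuousLinearMap.bilinearComp (ContinuousLinearMap.fst ℝ E ℝ) (ContinuousLinearMap.fst ℝ E ℝ)),
    fun q q' => ?_⟩
  simp only [ContinuousLinearMap.comp_add, add_apply, ContinuousLinearMap.comp_apply,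
    ContinuousLinearMap.compL_apply, ContinuousLinearMap.bilinearComp_apply, ContinuousLinearMap.coe_snd',
    ContinuousLinearMap.coe_fst', ContinuousLinearMap.lsmul_apply, map_smul, ContinuousLinearMap.inl_apply,
    Prod.smul_mk, smul_eq_mul, mul_zero, IsBoundedBilinearMap.toContinuousLinearMap_apply, Prod.mk_add_mk, add_zero]

end Summit.AnomalousDissipation.AnomalousDissipation.Theorems.RobustLoudUpgrade.LsFamilyPeriodic

end
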